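import Literature.AlgebraicGeometry.Motives.ChartGermsGenericPoint
import Literature.AlgebraicGeometry.Motives.PlueckerChartForms
import Literature.AlgebraicGeometry.Motives.ProjectiveSpaceFormDivisors
import HarnessLib

/-!
# Integral line forms at every base point from a morphism to the Plücker space

Let `T` be an integral `k`-scheme, `f : T → ℙ^{N²+2N}_k` a `k`-morphism to the Plücker space of
lines in `ℙᴺ`, whose generic point is the `k(T)`-point `[P]` with `P_{(i,j)} = (u ∧ r)_{ij}` the
Plücker coordinates of the `k(T)`-line `span(u, r)` (`u, r` independent). Then at EVERY point
`t ∈ T` there are `N - 1` integral vectors `wv_l ∈ 𝒪_{T,t}^{N+1}` whose reductions modulo `𝔪_t` are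
linearly independent over `κ(t)` and whose images in `k(T)^{N+1}` are coefficient vectors of linear
forms VANISHING ON THE LINE `span(u, r)` (`ProjFamily.exists_integralLineForms_of_pluecker`): on the
chart `p_{a₁a₂}(t) ≠ 0` they are the point–line incidence forms
`x_m - (p_{a₁m}/p_{a₁a₂}) x_{a₂} + (p_{a₂m}/p_{a₁a₂}) x_{a₁}`, `m ∉ {a₁, a₂}`, with coefficients the
germs of `f^*(p_c/p_{a₁a₂})` (`Motives/ChartGermsGenericPoint`, `Motives/PlueckerChartForms`). This
is the input "the line map extends to `t`" of the vertical-limit theorems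
(`ProjFamily.exists_forms_of_vertical_of_mem`, `ProjFamily.exists_fibre_forms_of_vertical_of_mem`).
Everything is proved.

## References

* [EisenbudHarris2016] D. Eisenbud, J. Harris, *3264 and All That*, §3.2.1–3.2.3, §6.3.
* [Hartshorne1977] R. Hartshorne, *Algebraic Geometry*, II Thm. 7.1 (a).
-/

noncomputable section

open CategoryTheory AlgebraicGeometry MvPolynomial TopologicalSpace

universe u

namespace Literature.AlgebraicGeometry.Motives

attribute [local instance] MvPolynomial.gradedAlgebra ProjBaseChange.algebraBase
  ProjFamily.functionFieldAlgebra

namespace ProjFamily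

open Segre GeneratingSections ProjectiveSpace FanoScheme

variable {k : Type u} [Field k]

/-- **Integral line forms at every base point.** See the module docstring.
[cite: EisenbudHarris2016, §3.2.3] [cite: Hartshorne1977, II Thm. 7.1 (a)] -/
theorem exists_integralLineForms_of_pluecker {N : ℕ} (hN : 1 ≤ N)
    (T : SchemeOver k) [IsIntegral T.left] (f : T ⟶ projectiveSpace (N * N + 2 * N) k)
    (u r : Fin (N + 1) → T.left.functionField)
    (P : Fin (N * N + 2 * N + 1) → T.left.functionField)
    (hPw : ∀ i j, P (plIdx N (i, j)) = wedge u r i j) (hP0 : P ≠ 0)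
    (hP : qgen T ≫ f.left = (pointOfVec k P hP0).left) (t : T.left) :
    ∃ wv : Fin (N - 1) → Fin (N + 1) → T.left.presheaf.stalk t,
      LinearIndependent (IsLocalRing.ResidueField (T.left.presheaf.stalk t))
        (fun l j => IsLocalRing.residue _ (wv l j)) ∧
      ∀ l (x : Fin (N + 1) → T.left.functionField), x ∈ Submodule.span T.left.functionField {u, r} →
        ∑ j, algebraMap (T.left.presheaf.stalk t) T.left.functionField (wv l j) * x j = 0 := by
  classical
  -- a chart `p_a(t) ≠ 0` and the index pair `a = (a₁, a₂)`
  obtain ⟨a, ha⟩ := ProjSpace.exists_X_notMem (f.left.base t)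
  have ht : t ∈ preU f.left a := (Proj.mem_basicOpen _ _ _).2 ha
  set a₁ : Fin (N + 1) := ((plIdx N).symm a).1 with ha₁
  set a₂ : Fin (N + 1) := ((plIdx N).symm a).2 with ha₂
  have hpla : plIdx N (a₁, a₂) = a := by rw [ha₁, ha₂, Prod.mk.eta, Equiv.apply_symm_apply]
  -- germs of the chart coordinates and their values at the generic point
  obtain ⟨hPa, hval⟩ := algebraMap_germ_homRatio T f P hP0 hP ht
  have hw12 : wedge u r a₁ a₂ ≠ 0 := by rwa [← hPw, hpla]
  have hne : a₁ ≠ a₂ := fun h => hw12 (by rw [h, wedge_self])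
  obtain ⟨ε, hε, hε12⟩ := exists_embedding_compl_pair hN hne
  let g : Fin (N * N + 2 * N + 1) → T.left.presheaf.stalk t :=
    fun c => T.left.presheaf.germ (preU f.left a) t ht (homRatio f.left a c)
  -- the integral chart vectors
  let wv : Fin (N - 1) → Fin (N + 1) → T.left.presheaf.stalk t := fun l =>
    Pi.single (ε l) (1 : T.left.presheaf.stalk t) +
      (-(g (plIdx N (a₁, ε l)))) • Pi.single a₂ (1 : T.left.presheaf.stalk t) +
      g (plIdx N (a₂, ε l)) • Pi.single a₁ (1 : T.left.presheaf.stalk t)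
  have hli : LinearIndependent (IsLocalRing.ResidueField (T.left.presheaf.stalk t))
      (fun l j => IsLocalRing.residue _ (wv l j)) :=
    linearIndependent_residue_chartVectors hε (fun l => (hε12 l).1) (fun l => (hε12 l).2)
      (fun l => -(g (plIdx N (a₁, ε l)))) (fun l => g (plIdx N (a₂, ε l)))
  refine ⟨wv, hli, fun l x hx => ?_⟩
  -- in `k(T)`: the coefficient vector of the chart form, which vanishes on the line
  let p : Fin (N + 1) → Fin (N + 1) → T.left.functionField := fun i j => P (plIdx N (i, j))
  have hpa : p a₁ a₂ = P a := by change P (plIdx N (a₁, a₂)) = P a; rw [hpla]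
  have hmap : ∀ j, algebraMap (T.left.presheaf.stalk t) T.left.functionField (wv l j) =
      (Pi.single (ε l) (1 : T.left.functionField) +
        (-(p a₁ (ε l) / p a₁ a₂)) • Pi.single a₂ (1 : T.left.functionField) +
        (p a₂ (ε l) / p a₁ a₂) • Pi.single a₁ (1 : T.left.functionField) :
          Fin (N + 1) → T.left.functionField) j := by
    intro j
    simp only [wv, Pi.add_apply, Pi.smul_apply, smul_eq_mul, map_add, map_mul, map_neg, Pi.single_apply,
      apply_ite (algebraMap (T.left.presheaf.stalk t) T.left.functionField), map_one, map_zero]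
    rw [hval, hval, hpa]
  simp_rw [hmap]
  rw [eval_sum_chartVector_mul T.left.functionField p a₁ a₂ (ε l) x]
  have hx' : x ∈ Submodule.span T.left.functionField {u, r} := hx
  have key := eval_chartLineForm_eq_zero u r hw12 (ε l) hx'
  simp only [p, hPw] at key ⊢
  exact key

end ProjFamily

end Literature.AlgebraicGeometry.Motives

end
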